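import Mathlib
import HarnessLib

/-!
# `NoHeavyLowerTail` (stmt-CriticalPhenomena-4575) — the cut-counting core of the CORNER event-gluing theorem:
# three near-minimum cuts through a common vertex cannot each isolate a private terminal ("no three-antichain")

Setting: a finite vertex type `V` and a multigraph given by symmetric edge multiplicities `c : V → V → ℕ`
(`c u v = c v u`; diagonal values never matter).  For vertex sets `S, T` write
`adj⟦c; S, T⟧ = ∑_{u ∈ S} ∑_{v ∈ T} c u v` (ordered adjacency count; a local notation, no definition is
introduced) and call `adj⟦c; S, Sᶜ⟧` the CUT of `S` (each crossing edge counted once).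

* `CutAntichain.cut_sdiff_add` — posimodularity as an IDENTITY (Korte–Vygen, Lemma 2.1(d)):
  `cut(A \ B) + cut(B \ A) + 2·adj⟦c; A ∩ B, (A ∪ B)ᶜ⟧ = cut A + cut B`.
* `CutAntichain.cut_inter₃_le` — the three-set inequality: with `Rᵢ = Uᵢ \ (Uⱼ ∪ Uₖ)`,
  `cut(U₁ ∩ U₂ ∩ U₃) + ∑ᵢ cut Rᵢ ≤ ∑ᵢ cut Uᵢ + 2·∑_{i<j} adj⟦c; Uᵢ ∩ Uⱼ, (Uᵢ ∪ Uⱼ)ᶜ⟧`.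
* `cut_inter₃_eq_zero` (**no three-antichain**): if `cut Uᵢ = m`, `m ≤ cut(Uᵢ \ Uⱼ)` for the six ordered pairs
  and `m ≤ cut Rᵢ` for the three private parts, then `cut(U₁ ∩ U₂ ∩ U₃) = 0`; `no_edge_out_of_inter₃`: hence no
  vertex of `U₁ ∩ U₂ ∩ U₃` is adjacent to a vertex outside it.

Use (coupling seat gen 2 of crux 4575, memo A5-COUPLING-gen2.md §4.6): in the near-one corner `w_e = 1 − λ_e ε` of
bond percolation the exit probability `P(o ↔ A, o ↮ b)` is carried by the cuts `U ∋ o` of minimum size `m` grabbing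
a relay; a relay `t ∈ U` then has `λ(t,b) = m`, so `Uᵢ \ Uⱼ ∋ tᵢ` and `Rᵢ ∋ tᵢ` have cut `≥ m`.  Three relays
pairwise separable by such cuts would give `Uᵢ ∋ o` as above, hence no edge leaves `U₁ ∩ U₂ ∩ U₃ ∋ o` while
`b ∉ U₁ ∩ U₂ ∩ U₃` — impossible in a connected graph.  So the exit relays have at most two minimal elements in the
"passes-through" preorder, and event gluing at the corner follows from the landed tripod exchange `C⁺`.
All proofs are finite bookkeeping: every identity/inequality is checked POINTWISE on ordered pairs `(u,v)` after
symmetrisation `(u,v) ↔ (v,u)`, where it is a decidable statement about at most six membership bits.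
-/

namespace Summit.CriticalPhenomena.PercolationContinuityZ3.Theorems

open Finset

variable {V : Type*} [Fintype V] [DecidableEq V]

-- Ordered adjacency count `∑_{u ∈ S} ∑_{v ∈ T} c u v` (local notation; no definition is introduced).
set_option quotPrecheck false in
local notation "adj⟦" c "; " S ", " T "⟧" =>
  (∑ u, ∑ v, if u ∈ S ∧ v ∈ T then (↑(c u v) : ℤ) else 0)

-- Truth table of the posimodularity identity on membership bits `a = (u∈A), b = (u∈B), a' = (v∈A), b' = (v∈B)`.
set_option quotPrecheck false in
local notation "posiI⟦" a ", " b ", " a' ", " b' "⟧" =>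
  ((if (a && !a') = true then (1:ℤ) else 0) + (if (b && !b') = true then (1:ℤ) else 0)
    - (if ((a && !b) && !(a' && !b')) = true then (1:ℤ) else 0)
    - (if ((b && !a) && !(b' && !a')) = true then (1:ℤ) else 0)
    - 2 * (if ((a && b) && (!a' && !b')) = true then (1:ℤ) else 0))

-- Truth table of the three-set inequality on the membership bits of `u` (`xᵢ`) and `v` (`yᵢ`) in `U₁,U₂,U₃`.
set_option quotPrecheck false in
local notation "triI⟦" x₁ ", " x₂ ", " x₃ ", " y₁ ", " y₂ ", " y₃ "⟧" =>
  ((if (x₁ && !y₁) = true then (1:ℤ) else 0) + (if (x₂ && !y₂) = true then (1:ℤ) else 0)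
      + (if (x₃ && !y₃) = true then (1:ℤ) else 0)
    + 2 * ((if ((x₁ && x₂) && (!y₁ && !y₂)) = true then (1:ℤ) else 0)
      + (if ((x₁ && x₃) && (!y₁ && !y₃)) = true then (1:ℤ) else 0)
      + (if ((x₂ && x₃) && (!y₂ && !y₃)) = true then (1:ℤ) else 0))
    - (if ((x₁ && !x₂ && !x₃) && !(y₁ && !y₂ && !y₃)) = true then (1:ℤ) else 0)
    - (if ((x₂ && !x₁ && !x₃) && !(y₂ && !y₁ && !y₃)) = true then (1:ℤ) else 0)
    - (if ((x₃ && !x₁ && !x₂) && !(y₃ && !y₁ && !y₂)) = true then (1:ℤ) else 0)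
    - (if ((x₁ && x₂ && x₃) && !(y₁ && y₂ && y₃)) = true then (1:ℤ) else 0))

namespace CutAntichain

omit [DecidableEq V] in
/-- A weighted double sum whose integrand is pointwise nonnegative after symmetrisation `(u,v) ↔ (v,u)` is
nonnegative (symmetric weights). [folklore] -/
theorem sum_sum_nonneg_of_symm (c : V → V → ℕ) (hc : ∀ u v, c u v = c v u) (φ : V → V → ℤ)
    (hφ : ∀ u v, 0 ≤ φ u v + φ v u) : 0 ≤ ∑ u, ∑ v, (c u v : ℤ) * φ u v := by
  have hswap : ∑ u, ∑ v, (c u v : ℤ) * φ u v = ∑ u, ∑ v, (c u v : ℤ) * φ v u := by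
    rw [Finset.sum_comm]
    refine Finset.sum_congr rfl fun u _ => Finset.sum_congr rfl fun v _ => ?_
    rw [hc v u]
  have hadd : (∑ u, ∑ v, (c u v : ℤ) * φ u v) + (∑ u, ∑ v, (c u v : ℤ) * φ v u) =
      ∑ u, ∑ v, (c u v : ℤ) * (φ u v + φ v u) := by
    rw [← Finset.sum_add_distrib]
    refine Finset.sum_congr rfl fun u _ => ?_
    rw [← Finset.sum_add_distrib]
    refine Finset.sum_congr rfl fun v _ => ?_
    ring
  have h2 : 2 * ∑ u, ∑ v, (c u v : ℤ) * φ u v = ∑ u, ∑ v, (c u v : ℤ) * (φ u v + φ v u) := by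
    rw [← hadd, ← hswap, two_mul]
  have h3 : 0 ≤ ∑ u, ∑ v, (c u v : ℤ) * (φ u v + φ v u) :=
    Finset.sum_nonneg fun u _ => Finset.sum_nonneg fun v _ =>
      mul_nonneg (by exact_mod_cast Nat.zero_le _) (hφ u v)
  linarith

omit [DecidableEq V] in
/-- A weighted double sum whose integrand is pointwise ANTIsymmetric under `(u,v) ↔ (v,u)` vanishes
(symmetric weights). [folklore] -/
theorem sum_sum_eq_zero_of_antisymm (c : V → V → ℕ) (hc : ∀ u v, c u v = c v u) (φ : V → V → ℤ)
    (hφ : ∀ u v, φ u v + φ v u = 0) : ∑ u, ∑ v, (c u v : ℤ) * φ u v = 0 := by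
  have h1 : 0 ≤ ∑ u, ∑ v, (c u v : ℤ) * φ u v :=
    sum_sum_nonneg_of_symm c hc φ fun u v => le_of_eq (hφ u v).symm
  have h2 : 0 ≤ ∑ u, ∑ v, (c u v : ℤ) * (-φ u v) :=
    sum_sum_nonneg_of_symm c hc (fun u v => -φ u v) fun u v => by have := hφ u v; linarith
  have h3 : ∑ u, ∑ v, (c u v : ℤ) * (-φ u v) = -(∑ u, ∑ v, (c u v : ℤ) * φ u v) := by
    rw [← Finset.sum_neg_distrib]
    refine Finset.sum_congr rfl fun u _ => ?_
    rw [← Finset.sum_neg_distrib]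
    refine Finset.sum_congr rfl fun v _ => ?_
    ring
  rw [h3] at h2
  linarith

/-- The adjacency count as a weighted sum with an indicator integrand. [this file] -/
theorem adj_eq_sum (c : V → V → ℕ) (S T : Finset V) :
    adj⟦c; S, T⟧ = ∑ u, ∑ v, (c u v : ℤ) * (if u ∈ S ∧ v ∈ T then 1 else 0) := by
  refine Finset.sum_congr rfl fun u _ => Finset.sum_congr rfl fun v _ => ?_
  split_ifs <;> simp

/-- Adjacency counts are nonnegative. [this file] -/
theorem adj_nonneg (c : V → V → ℕ) (S T : Finset V) : 0 ≤ adj⟦c; S, T⟧ :=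
  Finset.sum_nonneg fun u _ => Finset.sum_nonneg fun v _ => by
    split_ifs
    · exact_mod_cast Nat.zero_le _
    · exact le_refl _

/-- The posimodularity truth table is antisymmetric under `(u,v) ↔ (v,u)` (16 cases, `decide`). [this file] -/
theorem posiIntegrand_antisymm : ∀ a b a' b' : Bool,
    posiI⟦a, b, a', b'⟧ + posiI⟦a', b', a, b⟧ = 0 := by decide

/-- **Posimodularity of the cut function as an identity** (Korte–Vygen, Lemma 2.1(d):
`|δ(X)| + |δ(Y)| = |δ(X∖Y)| + |δ(Y∖X)| + 2|E(X∩Y, V∖(X∪Y))|`, here for multigraphs given by multiplicities):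
`cut(A \ B) + cut(B \ A) + 2·adj⟦c; A ∩ B, (A ∪ B)ᶜ⟧ = cut A + cut B`.
[cite: KorteVygen2018, Lemma 2.1(d) (§2.1)] -/
theorem cut_sdiff_add (c : V → V → ℕ) (hc : ∀ u v, c u v = c v u) (A B : Finset V) :
    adj⟦c; A \ B, (A \ B)ᶜ⟧ + adj⟦c; B \ A, (B \ A)ᶜ⟧ + 2 * adj⟦c; A ∩ B, (A ∪ B)ᶜ⟧ =
      adj⟦c; A, Aᶜ⟧ + adj⟦c; B, Bᶜ⟧ := by
  have key : ∑ u, ∑ v, (c u v : ℤ) * posiI⟦decide (u ∈ A), decide (u ∈ B), decide (v ∈ A), decide (v ∈ B)⟧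
      = 0 :=
    sum_sum_eq_zero_of_antisymm c hc _ fun u v =>
      posiIntegrand_antisymm (decide (u ∈ A)) (decide (u ∈ B)) (decide (v ∈ A)) (decide (v ∈ B))
  have expand : ∑ u, ∑ v, (c u v : ℤ) * posiI⟦decide (u ∈ A), decide (u ∈ B), decide (v ∈ A), decide (v ∈ B)⟧
      = adj⟦c; A, Aᶜ⟧ + adj⟦c; B, Bᶜ⟧ - adj⟦c; A \ B, (A \ B)ᶜ⟧ - adj⟦c; B \ A, (B \ A)ᶜ⟧
        - 2 * adj⟦c; A ∩ B, (A ∪ B)ᶜ⟧ := by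
    simp only [adj_eq_sum, Finset.mul_sum, ← Finset.sum_sub_distrib, ← Finset.sum_add_distrib]
    refine Finset.sum_congr rfl fun u _ => Finset.sum_congr rfl fun v _ => ?_
    simp only [mem_compl, mem_sdiff, mem_inter, mem_union, Bool.and_eq_true, Bool.not_eq_true',
      decide_eq_true_eq, decide_eq_false_iff_not]
    by_cases ha : u ∈ A <;> by_cases hb : u ∈ B <;> by_cases ha' : v ∈ A <;> by_cases hb' : v ∈ B
    all_goals simp [ha, hb, ha', hb']
    all_goals ring
  rw [expand] at key
  linarith

/-- The three-set truth table is nonnegative after symmetrisation `(u,v) ↔ (v,u)` (64 cases, `decide`). [this file] -/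
theorem triIntegrand_symm : ∀ x₁ x₂ x₃ y₁ y₂ y₃ : Bool,
    0 ≤ triI⟦x₁, x₂, x₃, y₁, y₂, y₃⟧ + triI⟦y₁, y₂, y₃, x₁, x₂, x₃⟧ := by decide

/-- **Three-set cut inequality.**  With `Rᵢ = Uᵢ \ (Uⱼ ∪ Uₖ)` the private parts:
`cut(U₁ ∩ U₂ ∩ U₃) + ∑ᵢ cut Rᵢ ≤ ∑ᵢ cut Uᵢ + 2 ∑_{i<j} adj⟦c; Uᵢ ∩ Uⱼ, (Uᵢ ∪ Uⱼ)ᶜ⟧`. [this file] -/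
theorem cut_inter₃_le (c : V → V → ℕ) (hc : ∀ u v, c u v = c v u) (U₁ U₂ U₃ : Finset V) :
    adj⟦c; U₁ ∩ U₂ ∩ U₃, (U₁ ∩ U₂ ∩ U₃)ᶜ⟧
      + (adj⟦c; U₁ \ (U₂ ∪ U₃), (U₁ \ (U₂ ∪ U₃))ᶜ⟧ + adj⟦c; U₂ \ (U₁ ∪ U₃), (U₂ \ (U₁ ∪ U₃))ᶜ⟧
        + adj⟦c; U₃ \ (U₁ ∪ U₂), (U₃ \ (U₁ ∪ U₂))ᶜ⟧) ≤
      (adj⟦c; U₁, U₁ᶜ⟧ + adj⟦c; U₂, U₂ᶜ⟧ + adj⟦c; U₃, U₃ᶜ⟧)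
        + 2 * (adj⟦c; U₁ ∩ U₂, (U₁ ∪ U₂)ᶜ⟧ + adj⟦c; U₁ ∩ U₃, (U₁ ∪ U₃)ᶜ⟧
          + adj⟦c; U₂ ∩ U₃, (U₂ ∪ U₃)ᶜ⟧) := by
  have key : 0 ≤ ∑ u, ∑ v, (c u v : ℤ) * triI⟦decide (u ∈ U₁), decide (u ∈ U₂), decide (u ∈ U₃),
      decide (v ∈ U₁), decide (v ∈ U₂), decide (v ∈ U₃)⟧ :=
    sum_sum_nonneg_of_symm c hc _ fun u v => triIntegrand_symm _ _ _ _ _ _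
  have expand : ∑ u, ∑ v, (c u v : ℤ) * triI⟦decide (u ∈ U₁), decide (u ∈ U₂), decide (u ∈ U₃),
      decide (v ∈ U₁), decide (v ∈ U₂), decide (v ∈ U₃)⟧ =
      (adj⟦c; U₁, U₁ᶜ⟧ + adj⟦c; U₂, U₂ᶜ⟧ + adj⟦c; U₃, U₃ᶜ⟧)
        + 2 * (adj⟦c; U₁ ∩ U₂, (U₁ ∪ U₂)ᶜ⟧ + adj⟦c; U₁ ∩ U₃, (U₁ ∪ U₃)ᶜ⟧
          + adj⟦c; U₂ ∩ U₃, (U₂ ∪ U₃)ᶜ⟧)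
        - (adj⟦c; U₁ \ (U₂ ∪ U₃), (U₁ \ (U₂ ∪ U₃))ᶜ⟧ + adj⟦c; U₂ \ (U₁ ∪ U₃), (U₂ \ (U₁ ∪ U₃))ᶜ⟧
          + adj⟦c; U₃ \ (U₁ ∪ U₂), (U₃ \ (U₁ ∪ U₂))ᶜ⟧)
        - adj⟦c; U₁ ∩ U₂ ∩ U₃, (U₁ ∩ U₂ ∩ U₃)ᶜ⟧ := by
    simp only [adj_eq_sum, Finset.mul_sum, ← Finset.sum_sub_distrib, ← Finset.sum_add_distrib]
    refine Finset.sum_congr rfl fun u _ => Finset.sum_congr rfl fun v _ => ?_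
    simp only [mem_compl, mem_sdiff, mem_inter, mem_union, Bool.and_eq_true, Bool.not_eq_true',
      decide_eq_true_eq, decide_eq_false_iff_not]
    by_cases h1 : u ∈ U₁ <;> by_cases h2 : u ∈ U₂ <;> by_cases h3 : u ∈ U₃ <;>
      by_cases k1 : v ∈ U₁ <;> by_cases k2 : v ∈ U₂ <;> by_cases k3 : v ∈ U₃
    all_goals simp [h1, h2, h3, k1, k2, k3]
    all_goals ring
  rw [expand] at key
  linarith

end CutAntichain

open CutAntichain

/-- **No three-antichain of near-minimum cuts.**  Symmetric multiplicities `c`; three vertex sets with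
`cut Uᵢ = m`, whose pairwise differences `Uᵢ \ Uⱼ` and private parts `Uᵢ \ (Uⱼ ∪ Uₖ)` all have cut `≥ m`
(in the application each contains a terminal of edge-connectivity `m` to the sink).  Then the common part
`U₁ ∩ U₂ ∩ U₃` has cut ZERO.  Proof: posimodularity forces `adj⟦c; Uᵢ ∩ Uⱼ, (Uᵢ ∪ Uⱼ)ᶜ⟧ = 0` for each pair, and
the three-set inequality then gives `cut(U₁∩U₂∩U₃) ≤ ∑ cut Uᵢ − ∑ cut Rᵢ ≤ 3m − 3m = 0`. [this file] -/
theorem cut_inter₃_eq_zero (c : V → V → ℕ) (hc : ∀ u v, c u v = c v u) (U₁ U₂ U₃ : Finset V) (m : ℤ)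
    (h₁ : adj⟦c; U₁, U₁ᶜ⟧ = m) (h₂ : adj⟦c; U₂, U₂ᶜ⟧ = m) (h₃ : adj⟦c; U₃, U₃ᶜ⟧ = m)
    (h₁₂ : m ≤ adj⟦c; U₁ \ U₂, (U₁ \ U₂)ᶜ⟧) (h₂₁ : m ≤ adj⟦c; U₂ \ U₁, (U₂ \ U₁)ᶜ⟧)
    (h₁₃ : m ≤ adj⟦c; U₁ \ U₃, (U₁ \ U₃)ᶜ⟧) (h₃₁ : m ≤ adj⟦c; U₃ \ U₁, (U₃ \ U₁)ᶜ⟧)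
    (h₂₃ : m ≤ adj⟦c; U₂ \ U₃, (U₂ \ U₃)ᶜ⟧) (h₃₂ : m ≤ adj⟦c; U₃ \ U₂, (U₃ \ U₂)ᶜ⟧)
    (r₁ : m ≤ adj⟦c; U₁ \ (U₂ ∪ U₃), (U₁ \ (U₂ ∪ U₃))ᶜ⟧)
    (r₂ : m ≤ adj⟦c; U₂ \ (U₁ ∪ U₃), (U₂ \ (U₁ ∪ U₃))ᶜ⟧)
    (r₃ : m ≤ adj⟦c; U₃ \ (U₁ ∪ U₂), (U₃ \ (U₁ ∪ U₂))ᶜ⟧) :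
    adj⟦c; U₁ ∩ U₂ ∩ U₃, (U₁ ∩ U₂ ∩ U₃)ᶜ⟧ = 0 := by
  have p12 := cut_sdiff_add c hc U₁ U₂
  have p13 := cut_sdiff_add c hc U₁ U₃
  have p23 := cut_sdiff_add c hc U₂ U₃
  have n12 := adj_nonneg c (U₁ ∩ U₂) (U₁ ∪ U₂)ᶜ
  have n13 := adj_nonneg c (U₁ ∩ U₃) (U₁ ∪ U₃)ᶜ
  have n23 := adj_nonneg c (U₂ ∩ U₃) (U₂ ∪ U₃)ᶜ
  have a12 : adj⟦c; U₁ ∩ U₂, (U₁ ∪ U₂)ᶜ⟧ = 0 := by linarith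
  have a13 : adj⟦c; U₁ ∩ U₃, (U₁ ∪ U₃)ᶜ⟧ = 0 := by linarith
  have a23 : adj⟦c; U₂ ∩ U₃, (U₂ ∪ U₃)ᶜ⟧ = 0 := by linarith
  have tri := cut_inter₃_le c hc U₁ U₂ U₃
  have hz := adj_nonneg c (U₁ ∩ U₂ ∩ U₃) (U₁ ∩ U₂ ∩ U₃)ᶜ
  rw [a12, a13, a23] at tri
  linarith

/-- **Corollary (the form used at the corner).**  Under the hypotheses of `cut_inter₃_eq_zero`, no vertex `o`
of the common part `U₁ ∩ U₂ ∩ U₃` is adjacent (positive multiplicity) to a vertex outside it; in particular the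
common part cannot contain a vertex joined to the sink in a connected graph. [this file] -/
theorem no_edge_out_of_inter₃ (c : V → V → ℕ) (hc : ∀ u v, c u v = c v u) (U₁ U₂ U₃ : Finset V) (m : ℤ)
    (h₁ : adj⟦c; U₁, U₁ᶜ⟧ = m) (h₂ : adj⟦c; U₂, U₂ᶜ⟧ = m) (h₃ : adj⟦c; U₃, U₃ᶜ⟧ = m)
    (h₁₂ : m ≤ adj⟦c; U₁ \ U₂, (U₁ \ U₂)ᶜ⟧) (h₂₁ : m ≤ adj⟦c; U₂ \ U₁, (U₂ \ U₁)ᶜ⟧)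
    (h₁₃ : m ≤ adj⟦c; U₁ \ U₃, (U₁ \ U₃)ᶜ⟧) (h₃₁ : m ≤ adj⟦c; U₃ \ U₁, (U₃ \ U₁)ᶜ⟧)
    (h₂₃ : m ≤ adj⟦c; U₂ \ U₃, (U₂ \ U₃)ᶜ⟧) (h₃₂ : m ≤ adj⟦c; U₃ \ U₂, (U₃ \ U₂)ᶜ⟧)
    (r₁ : m ≤ adj⟦c; U₁ \ (U₂ ∪ U₃), (U₁ \ (U₂ ∪ U₃))ᶜ⟧)
    (r₂ : m ≤ adj⟦c; U₂ \ (U₁ ∪ U₃), (U₂ \ (U₁ ∪ U₃))ᶜ⟧)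
    (r₃ : m ≤ adj⟦c; U₃ \ (U₁ ∪ U₂), (U₃ \ (U₁ ∪ U₂))ᶜ⟧)
    {o v : V} (ho : o ∈ U₁ ∩ U₂ ∩ U₃) (hv : v ∉ U₁ ∩ U₂ ∩ U₃) : c o v = 0 := by
  have hz := cut_inter₃_eq_zero c hc U₁ U₂ U₃ m h₁ h₂ h₃ h₁₂ h₂₁ h₁₃ h₃₁ h₂₃ h₃₂ r₁ r₂ r₃
  set Z := U₁ ∩ U₂ ∩ U₃ with hZ
  have hterm : ∀ u w : V, 0 ≤ (if u ∈ Z ∧ w ∈ Zᶜ then (c u w : ℤ) else 0) := fun u w => by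
    split_ifs
    · exact_mod_cast Nat.zero_le _
    · exact le_refl _
  have hrow : (∑ w, if o ∈ Z ∧ w ∈ Zᶜ then (c o w : ℤ) else 0) ≤
      ∑ u, ∑ w, if u ∈ Z ∧ w ∈ Zᶜ then (c u w : ℤ) else 0 :=
    Finset.single_le_sum (f := fun u => ∑ w, if u ∈ Z ∧ w ∈ Zᶜ then (c u w : ℤ) else 0)
      (fun u _ => Finset.sum_nonneg fun w _ => hterm u w) (Finset.mem_univ o)
  have hone : (if o ∈ Z ∧ v ∈ Zᶜ then (c o v : ℤ) else 0) ≤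
      ∑ w, if o ∈ Z ∧ w ∈ Zᶜ then (c o w : ℤ) else 0 :=
    Finset.single_le_sum (f := fun w => if o ∈ Z ∧ w ∈ Zᶜ then (c o w : ℤ) else 0)
      (fun w _ => hterm o w) (Finset.mem_univ v)
  have hv' : v ∈ Zᶜ := mem_compl.mpr hv
  have hge := hterm o v
  have hval : (if o ∈ Z ∧ v ∈ Zᶜ then (c o v : ℤ) else 0) = 0 := by linarith
  rw [if_pos ⟨ho, hv'⟩] at hval
  exact_mod_cast hval

/-- **No three-antichain, cuts of different sizes (the cross-layer form).**  As `cut_inter₃_eq_zero`, but each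
`Uᵢ` has its own size `mᵢ`: if `cut Uᵢ = mᵢ`, `mᵢ ≤ cut(Uᵢ \ Uⱼ)` (six ordered pairs) and `mᵢ ≤ cut(Uᵢ \ (Uⱼ ∪ Uₖ))`,
then `cut(U₁ ∩ U₂ ∩ U₃) = 0`.  (In the corner application the `Uᵢ` are o-containing minimum cuts for terminals of
DIFFERENT connectivities `mᵢ = λ(tᵢ,b)`; the same edge count applies verbatim.) [this file] -/
theorem cut_inter₃_eq_zero_of_sizes (c : V → V → ℕ) (hc : ∀ u v, c u v = c v u) (U₁ U₂ U₃ : Finset V)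
    (m₁ m₂ m₃ : ℤ)
    (h₁ : adj⟦c; U₁, U₁ᶜ⟧ = m₁) (h₂ : adj⟦c; U₂, U₂ᶜ⟧ = m₂) (h₃ : adj⟦c; U₃, U₃ᶜ⟧ = m₃)
    (h₁₂ : m₁ ≤ adj⟦c; U₁ \ U₂, (U₁ \ U₂)ᶜ⟧) (h₂₁ : m₂ ≤ adj⟦c; U₂ \ U₁, (U₂ \ U₁)ᶜ⟧)
    (h₁₃ : m₁ ≤ adj⟦c; U₁ \ U₃, (U₁ \ U₃)ᶜ⟧) (h₃₁ : m₃ ≤ adj⟦c; U₃ \ U₁, (U₃ \ U₁)ᶜ⟧)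
    (h₂₃ : m₂ ≤ adj⟦c; U₂ \ U₃, (U₂ \ U₃)ᶜ⟧) (h₃₂ : m₃ ≤ adj⟦c; U₃ \ U₂, (U₃ \ U₂)ᶜ⟧)
    (r₁ : m₁ ≤ adj⟦c; U₁ \ (U₂ ∪ U₃), (U₁ \ (U₂ ∪ U₃))ᶜ⟧)
    (r₂ : m₂ ≤ adj⟦c; U₂ \ (U₁ ∪ U₃), (U₂ \ (U₁ ∪ U₃))ᶜ⟧)
    (r₃ : m₃ ≤ adj⟦c; U₃ \ (U₁ ∪ U₂), (U₃ \ (U₁ ∪ U₂))ᶜ⟧) :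
    adj⟦c; U₁ ∩ U₂ ∩ U₃, (U₁ ∩ U₂ ∩ U₃)ᶜ⟧ = 0 := by
  have p12 := cut_sdiff_add c hc U₁ U₂
  have p13 := cut_sdiff_add c hc U₁ U₃
  have p23 := cut_sdiff_add c hc U₂ U₃
  have n12 := adj_nonneg c (U₁ ∩ U₂) (U₁ ∪ U₂)ᶜ
  have n13 := adj_nonneg c (U₁ ∩ U₃) (U₁ ∪ U₃)ᶜ
  have n23 := adj_nonneg c (U₂ ∩ U₃) (U₂ ∪ U₃)ᶜ
  have a12 : adj⟦c; U₁ ∩ U₂, (U₁ ∪ U₂)ᶜ⟧ = 0 := by linarith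
  have a13 : adj⟦c; U₁ ∩ U₃, (U₁ ∪ U₃)ᶜ⟧ = 0 := by linarith
  have a23 : adj⟦c; U₂ ∩ U₃, (U₂ ∪ U₃)ᶜ⟧ = 0 := by linarith
  have tri := cut_inter₃_le c hc U₁ U₂ U₃
  have hz := adj_nonneg c (U₁ ∩ U₂ ∩ U₃) (U₁ ∩ U₂ ∩ U₃)ᶜ
  rw [a12, a13, a23] at tri
  linarith

/-- **Corollary (cross-layer form used at the corner).**  Under the hypotheses of `cut_inter₃_eq_zero_of_sizes`
no vertex of `U₁ ∩ U₂ ∩ U₃` is adjacent to a vertex outside it. [this file] -/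
theorem no_edge_out_of_inter₃_of_sizes (c : V → V → ℕ) (hc : ∀ u v, c u v = c v u) (U₁ U₂ U₃ : Finset V)
    (m₁ m₂ m₃ : ℤ)
    (h₁ : adj⟦c; U₁, U₁ᶜ⟧ = m₁) (h₂ : adj⟦c; U₂, U₂ᶜ⟧ = m₂) (h₃ : adj⟦c; U₃, U₃ᶜ⟧ = m₃)
    (h₁₂ : m₁ ≤ adj⟦c; U₁ \ U₂, (U₁ \ U₂)ᶜ⟧) (h₂₁ : m₂ ≤ adj⟦c; U₂ \ U₁, (U₂ \ U₁)ᶜ⟧)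
    (h₁₃ : m₁ ≤ adj⟦c; U₁ \ U₃, (U₁ \ U₃)ᶜ⟧) (h₃₁ : m₃ ≤ adj⟦c; U₃ \ U₁, (U₃ \ U₁)ᶜ⟧)
    (h₂₃ : m₂ ≤ adj⟦c; U₂ \ U₃, (U₂ \ U₃)ᶜ⟧) (h₃₂ : m₃ ≤ adj⟦c; U₃ \ U₂, (U₃ \ U₂)ᶜ⟧)
    (r₁ : m₁ ≤ adj⟦c; U₁ \ (U₂ ∪ U₃), (U₁ \ (U₂ ∪ U₃))ᶜ⟧)
    (r₂ : m₂ ≤ adj⟦c; U₂ \ (U₁ ∪ U₃), (U₂ \ (U₁ ∪ U₃))ᶜ⟧)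
    (r₃ : m₃ ≤ adj⟦c; U₃ \ (U₁ ∪ U₂), (U₃ \ (U₁ ∪ U₂))ᶜ⟧)
    {o v : V} (ho : o ∈ U₁ ∩ U₂ ∩ U₃) (hv : v ∉ U₁ ∩ U₂ ∩ U₃) : c o v = 0 := by
  have hz := cut_inter₃_eq_zero_of_sizes c hc U₁ U₂ U₃ m₁ m₂ m₃ h₁ h₂ h₃ h₁₂ h₂₁ h₁₃ h₃₁ h₂₃ h₃₂ r₁ r₂ r₃
  set Z := U₁ ∩ U₂ ∩ U₃ with hZ
  have hterm : ∀ u w : V, 0 ≤ (if u ∈ Z ∧ w ∈ Zᶜ then (c u w : ℤ) else 0) := fun u w => by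
    split_ifs
    · exact_mod_cast Nat.zero_le _
    · exact le_refl _
  have hrow : (∑ w, if o ∈ Z ∧ w ∈ Zᶜ then (c o w : ℤ) else 0) ≤
      ∑ u, ∑ w, if u ∈ Z ∧ w ∈ Zᶜ then (c u w : ℤ) else 0 :=
    Finset.single_le_sum (f := fun u => ∑ w, if u ∈ Z ∧ w ∈ Zᶜ then (c u w : ℤ) else 0)
      (fun u _ => Finset.sum_nonneg fun w _ => hterm u w) (Finset.mem_univ o)
  have hone : (if o ∈ Z ∧ v ∈ Zᶜ then (c o v : ℤ) else 0) ≤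
      ∑ w, if o ∈ Z ∧ w ∈ Zᶜ then (c o w : ℤ) else 0 :=
    Finset.single_le_sum (f := fun w => if o ∈ Z ∧ w ∈ Zᶜ then (c o w : ℤ) else 0)
      (fun w _ => hterm o w) (Finset.mem_univ v)
  have hv' : v ∈ Zᶜ := mem_compl.mpr hv
  have hge := hterm o v
  have hval : (if o ∈ Z ∧ v ∈ Zᶜ then (c o v : ℤ) else 0) = 0 := by linarith
  rw [if_pos ⟨ho, hv'⟩] at hval
  exact_mod_cast hval

end Summit.CriticalPhenomena.PercolationContinuityZ3.Theorems
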